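import Summits.ValiantsHypothesis.ValiantsHypothesis.Theorems.KPlusLogSqLawTridiagonalRealStaticUnitMonotoneInertia

/-!
# Route «KPlusLogSqLaw», crux `WeakLifting` (stmt-ValiantsHypothesis-19561) — REAL side of the tridiagonal sector:
# the UNIT-COEFFICIENT sub-sector — Sturm-count PARITY and the EXACT TOTAL BY THE LEADING SIGN (sizes 3, 4, 5, 6, 8)

HONEST FRAMING.  Helper theorems (`--supports stmt-ValiantsHypothesis-19561 --as helper`), seat val-sym-lift-p1 (g19), cell `pub-symmetroid`,
2026-08-28; completes `…UnitMonotoneInertia` (p642748).  Continuants `D_k = pathDet (fun _ => 1) d (fun _ => 1) f k`, Sturm count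
`V(x) = #{k < m : D_k(x)D_{k+1}(x) < 0}`.  Proved here:
* **STURM-COUNT PARITY** (`sturmCount_mod_two`, all sizes, any design, any `x` with no vanishing continuant): `V(x) ≡ [D_m(x) < 0] (mod 2)`
  (`D_0 = 1 > 0`; a sign sequence starting at `+` changes sign an odd number of times iff it ends at `−`);
* `exists_scale_beyond_all_roots` (a generic scale beyond a given bound and beyond every root of every `D_k`), `eventually_sign_eq_leadingCoeff`
  (beyond some scale `D_m` has the sign of its leading coefficient);
* **LEADING-SIGN TOTAL LAW** (`card_posRoots_mod_two`, `card_posRoots_eq_of_leadingCoeff`): for every one-signed (positive-slope) unit design of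
  size `m ∈ {3,4,5,6,8}` the number `Z` of distinct positive zeros of `D_m` (all simple) satisfies `Z ≡ [lc(D_m) < 0] (mod 2)` and
  `Z ∈ {q, q+1}`, `q = ⌊(m+1)/3⌋`; hence **`Z = q + [ (−1)^q ≠ sign lc(D_m) ]`** — the exact total from ONE integer sign, the leading coefficient
  of the top matching exponent (`card_posRoots_four_eq_two_iff`: `Z(D_4) = 2 ⟺ lc > 0`, i.e. `2f_0 + 2f_2 > d_0 + 2f_1 + d_3`;
  `card_posRoots_six_eq_three_iff`: `Z(D_6) = 3 ⟺ lc < 0`; `card_posRoots_eight_eq_four_iff`: `Z(D_8) = 4 ⟺ lc > 0`).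
Nothing here is an upper law for the register (α NO MOVER); nothing bears on `WeakLifting` / `TropicalB` (stmt-19771) in their windows, Conjecture B,
the Door-A registers, `MatrixDescartes` (stmt-18050) or VP ≠ VNP.
[this seat; folklore: Sturm sequences, sign of a polynomial at infinity]
-/

-- `Summit.ValiantsHypothesis.ValiantsHypothesis.…` repeats a component by the D-0017 layout (single-conjunct summit); the name is mandated.
set_option linter.dupNamespace false
set_option autoImplicit false

namespace Summit.ValiantsHypothesis.ValiantsHypothesis.Theorems.KPlusLogSqLaw
namespace StaticTridiagonalRealUnit

open Real Finset Polynomial Filter Topology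
open Summit.ValiantsHypothesis.ValiantsHypothesis.Theorems.KPlusLogSqLaw.StaticTridiagonalRealPotential (pathDet)

variable (d : ℕ → ℕ) (f : ℕ → ℕ)

/-! ### 1. Parity of the Sturm count -/

/-- the Sturm count as a range sum. [bookkeeping] -/
theorem sturmCount_eq_sum (m : ℕ) (x : ℝ) :
    (Finset.univ.filter fun k : Fin m =>
        (pathDet (fun _ => (1 : ℝ)) d (fun _ => (1 : ℝ)) f k).eval x * (pathDet (fun _ => (1 : ℝ)) d (fun _ => (1 : ℝ)) f (k + 1)).eval x < 0).card =
      ∑ k ∈ range m, if (pathDet (fun _ => (1 : ℝ)) d (fun _ => (1 : ℝ)) f k).eval x *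
        (pathDet (fun _ => (1 : ℝ)) d (fun _ => (1 : ℝ)) f (k + 1)).eval x < 0 then 1 else 0 := by
  rw [Finset.card_filter, Fin.sum_univ_eq_sum_range (fun k => if (pathDet (fun _ => (1 : ℝ)) d (fun _ => (1 : ℝ)) f k).eval x *
        (pathDet (fun _ => (1 : ℝ)) d (fun _ => (1 : ℝ)) f (k + 1)).eval x < 0 then 1 else 0) m]

/-- **STURM-COUNT PARITY (all sizes, any exponents)**: if no continuant `D_k` (`k ≤ m`) vanishes at `x`, then
`V(x) ≡ [D_m(x) < 0] (mod 2)`. [this file] -/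
theorem sturmCount_mod_two (m : ℕ) (x : ℝ) (hne : ∀ k, k ≤ m → (pathDet (fun _ => (1 : ℝ)) d (fun _ => (1 : ℝ)) f k).eval x ≠ 0) :
    (Finset.univ.filter fun k : Fin m =>
        (pathDet (fun _ => (1 : ℝ)) d (fun _ => (1 : ℝ)) f k).eval x * (pathDet (fun _ => (1 : ℝ)) d (fun _ => (1 : ℝ)) f (k + 1)).eval x < 0).card % 2 =
      if (pathDet (fun _ => (1 : ℝ)) d (fun _ => (1 : ℝ)) f m).eval x < 0 then 1 else 0 := by
  rw [sturmCount_eq_sum]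
  induction m with
  | zero =>
    rw [sum_range_zero, (eval_unit_zero_one d f x).1]; norm_num
  | succ m ih =>
    rw [sum_range_succ, Nat.add_mod, ih (fun k hk => hne k (by omega))]
    have hm := hne m (by omega)
    have hm1 := hne (m + 1) le_rfl
    by_cases h0 : (pathDet (fun _ => (1 : ℝ)) d (fun _ => (1 : ℝ)) f m).eval x < 0
    · rw [if_pos h0]
      by_cases h1 : (pathDet (fun _ => (1 : ℝ)) d (fun _ => (1 : ℝ)) f (m + 1)).eval x < 0
      · rw [if_pos h1, if_neg (not_lt.2 (mul_pos_of_neg_of_neg h0 h1).le)]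
      · have h1' : 0 < (pathDet (fun _ => (1 : ℝ)) d (fun _ => (1 : ℝ)) f (m + 1)).eval x := lt_of_le_of_ne (not_lt.1 h1) hm1.symm
        rw [if_neg h1, if_pos (mul_neg_of_neg_of_pos h0 h1')]
    · have h0' : 0 < (pathDet (fun _ => (1 : ℝ)) d (fun _ => (1 : ℝ)) f m).eval x := lt_of_le_of_ne (not_lt.1 h0) hm.symm
      rw [if_neg h0]
      by_cases h1 : (pathDet (fun _ => (1 : ℝ)) d (fun _ => (1 : ℝ)) f (m + 1)).eval x < 0
      · rw [if_pos h1, if_pos (mul_neg_of_pos_of_neg h0' h1)]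
      · have h1' : 0 < (pathDet (fun _ => (1 : ℝ)) d (fun _ => (1 : ℝ)) f (m + 1)).eval x := lt_of_le_of_ne (not_lt.1 h1) hm1.symm
        rw [if_neg h1, if_neg (not_lt.2 (mul_pos h0' h1').le)]

/-! ### 2. Far scales -/

/-- a generic scale beyond a given bound and beyond every root of every continuant `D_k`, `k ≤ m`. [bookkeeping] -/
theorem exists_scale_beyond_all_roots (m : ℕ) (hslope : ∀ k, k + 1 < m → d k + d (k + 1) < 2 * f k) (B : ℝ) :
    ∃ b : ℝ, B ≤ b ∧ 1 < b ∧ (∀ k, k ≤ m → (pathDet (fun _ => (1 : ℝ)) d (fun _ => (1 : ℝ)) f k).eval b ≠ 0) ∧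
      ∀ k, k ≤ m → ∀ t, t ∈ (pathDet (fun _ => (1 : ℝ)) d (fun _ => (1 : ℝ)) f k).roots → t < b := by
  classical
  have hP : ∀ k, k ≤ m → pathDet (fun _ => (1 : ℝ)) d (fun _ => (1 : ℝ)) f k ≠ 0 := by
    intro k hk h0
    have hpos : 0 < (pathDet (fun _ => (1 : ℝ)) d (fun _ => (1 : ℝ)) f k).eval (1 / 4) := by
      rcases Nat.eq_zero_or_pos k with rfl | hk0
      · rw [(eval_unit_zero_one d f _).1]; exact one_pos
      · obtain ⟨k', rfl⟩ : ∃ k', k = k' + 1 := ⟨k - 1, by omega⟩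
        exact (continuant_pos_of_le_quarter d f m (1 / 4) (by norm_num) le_rfl hslope k' (by omega)).1
    rw [h0, eval_zero] at hpos
    exact lt_irrefl _ hpos
  set b : ℝ := |B| + 2 + ∑ k ∈ range (m + 1), ((pathDet (fun _ => (1 : ℝ)) d (fun _ => (1 : ℝ)) f k).roots.map (fun t => |t|)).sum
    with hb_def
  have hsum_nonneg : ∀ k, 0 ≤ ((pathDet (fun _ => (1 : ℝ)) d (fun _ => (1 : ℝ)) f k).roots.map (fun t => |t|)).sum := fun k =>
    Multiset.sum_nonneg fun x hx => by
      obtain ⟨t, -, rfl⟩ := Multiset.mem_map.1 hx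
      exact abs_nonneg t
  have hS : 0 ≤ ∑ k ∈ range (m + 1), ((pathDet (fun _ => (1 : ℝ)) d (fun _ => (1 : ℝ)) f k).roots.map (fun t => |t|)).sum :=
    Finset.sum_nonneg fun k _ => hsum_nonneg k
  have hlt : ∀ k, k ≤ m → ∀ t, t ∈ (pathDet (fun _ => (1 : ℝ)) d (fun _ => (1 : ℝ)) f k).roots → t < b := by
    intro k hk t ht
    have h1 : |t| ≤ ((pathDet (fun _ => (1 : ℝ)) d (fun _ => (1 : ℝ)) f k).roots.map (fun t => |t|)).sum :=
      Multiset.single_le_sum (fun x hx => by obtain ⟨t, -, rfl⟩ := Multiset.mem_map.1 hx; exact abs_nonneg t) _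
        (Multiset.mem_map_of_mem _ ht)
    have h2 : ((pathDet (fun _ => (1 : ℝ)) d (fun _ => (1 : ℝ)) f k).roots.map (fun t => |t|)).sum ≤
        ∑ j ∈ range (m + 1), ((pathDet (fun _ => (1 : ℝ)) d (fun _ => (1 : ℝ)) f j).roots.map (fun t => |t|)).sum :=
      Finset.single_le_sum (fun j _ => hsum_nonneg j) (mem_range.2 (by omega))
    have h3 : t ≤ |t| := le_abs_self t
    have h4 : 0 ≤ |B| := abs_nonneg B
    rw [hb_def]; linarith
  refine ⟨b, ?_, ?_, fun k hk h0 => ?_, hlt⟩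
  · rw [hb_def]; linarith [le_abs_self B]
  · rw [hb_def]; linarith [abs_nonneg B]
  · exact lt_irrefl _ (hlt k hk b ((mem_roots (hP k hk)).2 h0))

/-- **sign at infinity**: a one-signed unit design (`m ≥ 3`) has `D_m(x)` of the sign of its (non-zero) leading coefficient for all large `x`.
[folklore] -/
theorem eventually_sign_eq_leadingCoeff (m : ℕ) (hm : 3 ≤ m) (hm8 : m ≤ 8) (hslope : ∀ k, k + 1 < m → d k + d (k + 1) < 2 * f k) :
    (pathDet (fun _ => (1 : ℝ)) d (fun _ => (1 : ℝ)) f m).leadingCoeff ≠ 0 ∧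
    ∃ B : ℝ, ∀ x, B ≤ x →
      (0 < (pathDet (fun _ => (1 : ℝ)) d (fun _ => (1 : ℝ)) f m).leadingCoeff → 0 < (pathDet (fun _ => (1 : ℝ)) d (fun _ => (1 : ℝ)) f m).eval x) ∧
      ((pathDet (fun _ => (1 : ℝ)) d (fun _ => (1 : ℝ)) f m).leadingCoeff < 0 → (pathDet (fun _ => (1 : ℝ)) d (fun _ => (1 : ℝ)) f m).eval x < 0) := by
  classical
  set P := pathDet (fun _ => (1 : ℝ)) d (fun _ => (1 : ℝ)) f m with hP_def
  -- `P ≠ 0` and `P` has a root in `(0,1)`, so its degree is positive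
  have hcount := card_posRoots_unit_interval_eq_div_three_sharp d f m hm hm8 hslope
  have hne : ((P.roots.toFinset).filter (fun t => 0 < t ∧ t < 1)).Nonempty := by
    rw [← Finset.card_pos, hcount]; omega
  obtain ⟨t, ht⟩ := hne
  rw [Finset.mem_filter, Multiset.mem_toFinset] at ht
  have hP0 : P ≠ 0 := fun h0 => by rw [h0, roots_zero] at ht; exact absurd ht.1 (Multiset.notMem_zero _)
  have hroot : IsRoot P t := (mem_roots hP0).1 ht.1
  have hdeg : 0 < P.degree := degree_pos_of_root hP0 hroot
  refine ⟨leadingCoeff_ne_zero.2 hP0, ?_⟩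
  rcases lt_or_gt_of_ne (leadingCoeff_ne_zero.2 hP0) with hneg | hpos
  · have hlim := Polynomial.tendsto_atBot_of_leadingCoeff_nonpos P hdeg hneg.le
    obtain ⟨B, hB⟩ := Filter.eventually_atTop.1 (hlim.eventually (eventually_lt_atBot (0 : ℝ)))
    exact ⟨B, fun x hx => ⟨fun h => absurd hneg (not_lt.2 h.le), fun _ => hB x hx⟩⟩
  · have hlim := Polynomial.tendsto_atTop_of_leadingCoeff_nonneg P hdeg hpos.le
    obtain ⟨B, hB⟩ := Filter.eventually_atTop.1 (hlim.eventually (eventually_gt_atTop (0 : ℝ)))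
    exact ⟨B, fun x hx => ⟨fun _ => hB x hx, fun h => absurd hpos (not_lt.2 h.le)⟩⟩

/-! ### 3. The exact total by the leading sign -/

/-- **all positive zeros are simple (`m ∈ {3,4,5,6,8}`)**: the distinct positive zeros of `D_m` are the positive zeros with multiplicity.
[this file] -/
theorem card_posRoots_eq_card_roots (m : ℕ) (hm : m = 3 ∨ m = 4 ∨ m = 5 ∨ m = 6 ∨ m = 8)
    (hslope : ∀ k, k + 1 < m → d k + d (k + 1) < 2 * f k) :
    (((pathDet (fun _ => (1 : ℝ)) d (fun _ => (1 : ℝ)) f m).roots.toFinset).filter (fun t => 0 < t)).card =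
      Multiset.card (((pathDet (fun _ => (1 : ℝ)) d (fun _ => (1 : ℝ)) f m).roots).filter (fun t => 0 < t)) := by
  classical
  have hm3 : 3 ≤ m := by omega
  have hm8 : m ≤ 8 := by omega
  rw [← Multiset.toFinset_filter]
  refine Multiset.toFinset_card_of_nodup ?_
  rw [Multiset.nodup_iff_count_le_one]
  intro t
  rw [Multiset.count_filter]
  split_ifs with h
  · rw [count_roots]
    by_cases hroot : (pathDet (fun _ => (1 : ℝ)) d (fun _ => (1 : ℝ)) f m).eval t = 0
    · rcases lt_trichotomy t 1 with h1 | rfl | h1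
      · exact (rootMultiplicity_eq_one_sharp d f m hm3 hm8 t h h1 hslope hroot).le
      · rw [rootMultiplicity_one_eq d f m hslope]; split_ifs <;> norm_num
      · rcases hm with rfl | rfl | rfl | rfl | rfl
        · exact (eval_ne_zero_above_one_three_five d f 3 (Or.inl rfl) t h1 hslope hroot).elim
        · exact (rootMultiplicity_eq_one_above_one_of_even d f 2 (Or.inl rfl) t h1 hslope hroot).le
        · exact (eval_ne_zero_above_one_three_five d f 5 (Or.inr rfl) t h1 hslope hroot).elim
        · exact (rootMultiplicity_eq_one_above_one_of_even d f 4 (Or.inr (Or.inl rfl)) t h1 hslope hroot).le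
        · exact (rootMultiplicity_eq_one_above_one_of_even d f 6 (Or.inr (Or.inr rfl)) t h1 hslope hroot).le
    · rw [rootMultiplicity_eq_zero hroot]; exact Nat.zero_le _
  · exact Nat.zero_le _

/-- **PARITY OF THE TOTAL (`m ∈ {3,4,5,6,8}`)**: the number `Z` of distinct positive zeros of a one-signed unit design satisfies
`Z ≡ [lc(D_m) < 0] (mod 2)` — and the leading coefficient is non-zero. [this file] -/
theorem card_posRoots_mod_two (m : ℕ) (hm : m = 3 ∨ m = 4 ∨ m = 5 ∨ m = 6 ∨ m = 8)
    (hslope : ∀ k, k + 1 < m → d k + d (k + 1) < 2 * f k) :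
    (((pathDet (fun _ => (1 : ℝ)) d (fun _ => (1 : ℝ)) f m).roots.toFinset).filter (fun t => 0 < t)).card % 2 =
      if (pathDet (fun _ => (1 : ℝ)) d (fun _ => (1 : ℝ)) f m).leadingCoeff < 0 then 1 else 0 := by
  classical
  have hm3 : 3 ≤ m := by omega
  have hm8 : m ≤ 8 := by omega
  obtain ⟨hlc, B, hB⟩ := eventually_sign_eq_leadingCoeff d f m hm3 hm8 hslope
  obtain ⟨b, hBb, hb1, hbne, hlt⟩ := exists_scale_beyond_all_roots d f m hslope B
  have hmono := card_roots_below_eq_sturm_of_ne_seven d f m hm (one_pos.trans hb1) hslope hbne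
  -- all positive roots lie below `b`
  have hfilt : ((pathDet (fun _ => (1 : ℝ)) d (fun _ => (1 : ℝ)) f m).roots).filter (fun t => 0 < t) =
      ((pathDet (fun _ => (1 : ℝ)) d (fun _ => (1 : ℝ)) f m).roots).filter (fun t => 0 < t ∧ t < b) :=
    Multiset.filter_congr fun t ht => ⟨fun h => ⟨h, hlt m le_rfl t ht⟩, fun h => h.1⟩
  rw [card_posRoots_eq_card_roots d f m hm hslope, hfilt, hmono, sturmCount_mod_two d f m b hbne]
  obtain ⟨hpos, hneg⟩ := hB b hBb
  rcases lt_or_gt_of_ne hlc with h | h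
  · rw [if_pos (hneg h), if_pos h]
  · rw [if_neg (not_lt.2 (hpos h).le), if_neg (not_lt.2 h.le)]

/-- **LEADING-SIGN TOTAL LAW (`m ∈ {3,4,5,6,8}`, all exponents)**: for a one-signed (positive-slope) unit design the number `Z` of distinct
positive zeros of `D_m` is `q = ⌊(m+1)/3⌋` or `q + 1`, decided by parity: `Z = q` if `q ≡ [lc(D_m) < 0] (mod 2)`, else `Z = q + 1`. [this file] -/
theorem card_posRoots_eq_of_leadingCoeff (m : ℕ) (hm : m = 3 ∨ m = 4 ∨ m = 5 ∨ m = 6 ∨ m = 8)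
    (hslope : ∀ k, k + 1 < m → d k + d (k + 1) < 2 * f k) :
    (((pathDet (fun _ => (1 : ℝ)) d (fun _ => (1 : ℝ)) f m).roots.toFinset).filter (fun t => 0 < t)).card =
      if ((m + 1) / 3) % 2 = (if (pathDet (fun _ => (1 : ℝ)) d (fun _ => (1 : ℝ)) f m).leadingCoeff < 0 then 1 else 0)
      then (m + 1) / 3 else (m + 1) / 3 + 1 := by
  classical
  have hm3 : 3 ≤ m := by omega
  have hm8 : m ≤ 8 := by omega
  have hpar := card_posRoots_mod_two d f m hm hslope
  have hP : pathDet (fun _ => (1 : ℝ)) d (fun _ => (1 : ℝ)) f m ≠ 0 :=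
    fun h0 => (eventually_sign_eq_leadingCoeff d f m hm3 hm8 hslope).1 (by rw [h0, leadingCoeff_zero])
  -- lower bound: the zeros in `(0,1)` and the resonance
  have hcap := card_posRoots_le_half d f m hm hslope
  have hbelow := card_posRoots_unit_interval_eq_div_three_sharp d f m hm3 hm8 hslope
  have hsub : ((pathDet (fun _ => (1 : ℝ)) d (fun _ => (1 : ℝ)) f m).roots.toFinset).filter (fun t => 0 < t ∧ t < 1) ∪
      ((pathDet (fun _ => (1 : ℝ)) d (fun _ => (1 : ℝ)) f m).roots.toFinset).filter (fun t => t = 1) ⊆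
      ((pathDet (fun _ => (1 : ℝ)) d (fun _ => (1 : ℝ)) f m).roots.toFinset).filter (fun t => 0 < t) := by
    intro t ht
    rw [Finset.mem_union, Finset.mem_filter, Finset.mem_filter] at ht
    rw [Finset.mem_filter]
    rcases ht with ⟨hr, h0, -⟩ | ⟨hr, rfl⟩
    · exact ⟨hr, h0⟩
    · exact ⟨hr, one_pos⟩
  have hdisj : Disjoint (((pathDet (fun _ => (1 : ℝ)) d (fun _ => (1 : ℝ)) f m).roots.toFinset).filter (fun t => 0 < t ∧ t < 1))
      (((pathDet (fun _ => (1 : ℝ)) d (fun _ => (1 : ℝ)) f m).roots.toFinset).filter (fun t => t = 1)) := by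
    rw [Finset.disjoint_filter]
    rintro t - ⟨-, ht⟩ rfl
    exact lt_irrefl _ ht
  have hres : (((pathDet (fun _ => (1 : ℝ)) d (fun _ => (1 : ℝ)) f m).roots.toFinset).filter (fun t => t = 1)).card =
      if m % 3 = 2 then 1 else 0 := by
    by_cases h : m % 3 = 2
    · rw [if_pos h, Finset.card_eq_one]
      refine ⟨1, ?_⟩
      ext t
      simp only [Finset.mem_filter, Multiset.mem_toFinset, mem_roots hP, IsRoot.def, Finset.mem_singleton]
      constructor
      · rintro ⟨-, rfl⟩; rfl
      · rintro rfl; exact ⟨by rw [eval_one_eq_sign, if_pos h], rfl⟩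
    · rw [if_neg h, Finset.card_eq_zero, Finset.filter_eq_empty_iff]
      rintro t ht rfl
      rw [Multiset.mem_toFinset, mem_roots hP, IsRoot.def, eval_one_eq_sign, if_neg h] at ht
      split_ifs at ht <;> norm_num at ht
  have hlow := Finset.card_le_card hsub
  have hq : m / 3 + (if m % 3 = 2 then 1 else 0) = (m + 1) / 3 := by split_ifs <;> omega
  rw [Finset.card_union_of_disjoint hdisj, hbelow, hres, hq] at hlow
  -- `q ≤ Z ≤ q + 1` with `q = ⌊(m+1)/3⌋`, and the parity decides
  have hcap' : (((pathDet (fun _ => (1 : ℝ)) d (fun _ => (1 : ℝ)) f m).roots.toFinset).filter (fun t => 0 < t)).card ≤ (m + 1) / 3 + 1 :=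
    hcap.trans (by omega)
  by_cases hn : (pathDet (fun _ => (1 : ℝ)) d (fun _ => (1 : ℝ)) f m).leadingCoeff < 0
  · rw [if_pos hn] at hpar ⊢
    split_ifs with hq2 <;> omega
  · rw [if_neg hn] at hpar ⊢
    split_ifs with hq2 <;> omega

/-- **size 4**: `Z(D_4) = 2 ⟺ lc(D_4) > 0` (else `Z = 1`). [this file] -/
theorem card_posRoots_four_eq_two_iff (hslope : ∀ k, k + 1 < 4 → d k + d (k + 1) < 2 * f k) :
    (((pathDet (fun _ => (1 : ℝ)) d (fun _ => (1 : ℝ)) f 4).roots.toFinset).filter (fun t => 0 < t)).card = 2 ↔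
      0 < (pathDet (fun _ => (1 : ℝ)) d (fun _ => (1 : ℝ)) f 4).leadingCoeff := by
  have h := card_posRoots_eq_of_leadingCoeff d f 4 (by norm_num) hslope
  have hlc := (eventually_sign_eq_leadingCoeff d f 4 (by norm_num) (by norm_num) hslope).1
  by_cases hn : (pathDet (fun _ => (1 : ℝ)) d (fun _ => (1 : ℝ)) f 4).leadingCoeff < 0
  · rw [if_pos hn] at h; norm_num at h; rw [h]
    exact ⟨fun h' => absurd h' (by norm_num), fun h' => absurd hn (not_lt.2 h'.le)⟩
  · rw [if_neg hn] at h; norm_num at h; rw [h]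
    exact ⟨fun _ => lt_of_le_of_ne (not_lt.1 hn) hlc.symm, fun _ => rfl⟩

/-- **size 6**: `Z(D_6) = 3 ⟺ lc(D_6) < 0` (else `Z = 2`). [this file] -/
theorem card_posRoots_six_eq_three_iff (hslope : ∀ k, k + 1 < 6 → d k + d (k + 1) < 2 * f k) :
    (((pathDet (fun _ => (1 : ℝ)) d (fun _ => (1 : ℝ)) f 6).roots.toFinset).filter (fun t => 0 < t)).card = 3 ↔
      (pathDet (fun _ => (1 : ℝ)) d (fun _ => (1 : ℝ)) f 6).leadingCoeff < 0 := by
  have h := card_posRoots_eq_of_leadingCoeff d f 6 (by norm_num) hslope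
  by_cases hn : (pathDet (fun _ => (1 : ℝ)) d (fun _ => (1 : ℝ)) f 6).leadingCoeff < 0
  · rw [if_pos hn] at h; norm_num at h; rw [h]
    exact ⟨fun _ => hn, fun _ => rfl⟩
  · rw [if_neg hn] at h; norm_num at h; rw [h]
    exact ⟨fun h' => absurd h' (by norm_num), fun h' => absurd h' hn⟩

/-- **size 8**: `Z(D_8) = 4 ⟺ lc(D_8) > 0` (else `Z = 3`). [this file] -/
theorem card_posRoots_eight_eq_four_iff (hslope : ∀ k, k + 1 < 8 → d k + d (k + 1) < 2 * f k) :
    (((pathDet (fun _ => (1 : ℝ)) d (fun _ => (1 : ℝ)) f 8).roots.toFinset).filter (fun t => 0 < t)).card = 4 ↔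
      0 < (pathDet (fun _ => (1 : ℝ)) d (fun _ => (1 : ℝ)) f 8).leadingCoeff := by
  have h := card_posRoots_eq_of_leadingCoeff d f 8 (by norm_num) hslope
  have hlc := (eventually_sign_eq_leadingCoeff d f 8 (by norm_num) (by norm_num) hslope).1
  by_cases hn : (pathDet (fun _ => (1 : ℝ)) d (fun _ => (1 : ℝ)) f 8).leadingCoeff < 0
  · rw [if_pos hn] at h; norm_num at h; rw [h]
    exact ⟨fun h' => absurd h' (by norm_num), fun h' => absurd hn (not_lt.2 h'.le)⟩
  · rw [if_neg hn] at h; norm_num at h; rw [h]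
    exact ⟨fun _ => lt_of_le_of_ne (not_lt.1 hn) hlc.symm, fun _ => rfl⟩

end StaticTridiagonalRealUnit
end Summit.ValiantsHypothesis.ValiantsHypothesis.Theorems.KPlusLogSqLaw
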